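import Literature.Probability.Percolation.UniquenessThreshold
import Literature.Barriers.CriticalPhenomena.BLPSCriticalReduction
import HarnessLib

/-!
# A `d`-dimensional isoperimetric inequality with `d > 1` forces SUPERLINEAR ball growth

Topic `Literature/Probability/Percolation`, namespace `Literature.Probability.Percolation` (lane `prim-bschramm`, stmt seat gen 38; lead g25 GO #7795
with the placement ruling 'Q1 → Literature').  Everything here is PROVED; theorems only (def-free, no instance, no notation), over the tree's
vocabulary: `IsoperimetricInequality G d` («UniquenessThreshold» :175, verbatim
`∃ c : ℝ, 0 < c ∧ ∀ S : Finset V, S.Nonempty → c * (S.card : ℝ) ^ ((d - 1) / d) ≤ ((outerBoundary G S).card : ℝ)` — the OUTER VERTEX boundary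
`outerBoundary G S = (S.biUnion N) \\ S` of «LatticeGraph»), `ballVolume G x n = (graphBall G x n).ncard` («SubexponentialGrowthZd» :138) and the `Finset`
balls `ballF` of «AmenableInvariantPercolationProofs» with `ballVolume_eq_card_ballF` («BLPSCriticalReduction»).

Source.  The direction 'isoperimetric inequality ⇒ growth of balls' (Lyons–Peres 2016, §6.1: the balls `B(x, n)` satisfy
`|B(x, n+1)| ≥ |B(x, n)| + |∂_V B(x, n)|`, so an isoperimetric inequality feeds a growth recursion; the `d = ∞` / positive-Cheeger-constant case is the
tree's `hasExponentialGrowth_of_not_isGraphAmenable`, «BLPSCriticalReduction» :135).  Here the elementary finite-dimensional case in its WEAKEST useful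
form: a `d`-dimensional inequality with `d > 1` excludes LINEAR growth.  (The sharp bound `|B(n)| ≥ (c n / d)^d` is not needed by the lane and not typed.)
Benjamini–Schramm 1996, p. 74: "`Dim(G) = sup {d > 0 : inf_S |∂S| / |S|^{(d-1)/d} > 0}`", Question 2 ("Does `Dim(G) > 1` imply `p_c(G) < 1`?").

* `card_ballF_succ_eq` — `|B(x, n+1)| = |B(x, n)| + |∂_V B(x, n)|` (the ball recursion is literally `B(n+1) = B(n) ∪ ⋃_{u ∈ B(n)} N(u)`).
* `not_linearGrowth_of_isoperimetricInequality` — `1 < d`, `IsoperimetricInequality G d` ⟹ `¬ ∃ C, ∀ n, |B(x, n)| ≤ C (n + 1)`: the recursion gives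
  `|B(n+1)| ≥ |B(n)| + c |B(n)|^{(d-1)/d}`, hence `|B(n)| ≥ 1 + c n`, hence increments `≥ c (1 + c n)^{(d-1)/d} → ∞`, incompatible with a linear bound.
[cite: LyonsPeres2016, §6.1 (growth of balls from the isoperimetric inequality)] [cite: BenjaminiSchramm1996, Question 2 (p. 74: Dim(G))]
-/

noncomputable section

namespace Literature.Probability.Percolation

open _root_.SimpleGraph Literature.Barriers.CriticalPhenomena Literature.Probability.LatticeModels
open scoped Classical

variable {V : Type} [DecidableEq V] (G : SimpleGraph V) [G.LocallyFinite]

/-- **The ball recursion counts the outer vertex boundary**: `|B(x, n+1)| = |B(x, n)| + |∂_V B(x, n)|` (`ballF_succ` is `B(n) ∪ ⋃_{u ∈ B(n)} N(u)` and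
`outerBoundary G S = (⋃_{u ∈ S} N(u)) \\ S`). [folklore] [cite: LyonsPeres2016, §6.1] -/
theorem card_ballF_succ_eq (x : V) (n : ℕ) :
    (ballF G x (n + 1)).card = (ballF G x n).card + (outerBoundary G (ballF G x n)).card := by
  rw [ballF_succ, outerBoundary, ← Finset.card_union_of_disjoint Finset.disjoint_sdiff, Finset.union_sdiff_self_eq_union]

/-- **A `d`-dimensional isoperimetric inequality with `d > 1` excludes linear growth**: no `C` has `|B(x, n)| ≤ C (n + 1)` for all `n`.
[cite: LyonsPeres2016, §6.1 (growth of balls from the isoperimetric inequality)] [cite: BenjaminiSchramm1996, Question 2 (p. 74)] -/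
theorem not_linearGrowth_of_isoperimetricInequality {d : ℝ} (hd : 1 < d) (hI : IsoperimetricInequality G d) (x : V) :
    ¬ ∃ C : ℝ, ∀ n : ℕ, (ballVolume G x n : ℝ) ≤ C * ((n : ℝ) + 1) := by
  rintro ⟨C, hC⟩
  obtain ⟨c, hc, hiso⟩ := hI
  set α : ℝ := (d - 1) / d with hα
  have hα0 : 0 < α := div_pos (by linarith) (by linarith)
  -- `b n := |B(x, n)|` as a real number
  set b : ℕ → ℝ := fun n => ((ballF G x n).card : ℝ) with hb
  have hbv : ∀ n : ℕ, (ballVolume G x n : ℝ) = b n := fun n => by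
    simp only [hb, ballVolume_eq_card_ballF G x n]
  have hb1 : ∀ n : ℕ, 1 ≤ b n := fun n => by
    simp only [hb]
    exact_mod_cast Finset.card_pos.2 ⟨x, mem_ballF_self x n⟩
  have hb0 : ∀ n : ℕ, 0 ≤ b n := fun n => zero_le_one.trans (hb1 n)
  -- the growth recursion
  have hstep : ∀ n : ℕ, b n + c * (b n) ^ α ≤ b (n + 1) := fun n => by
    have h := hiso (ballF G x n) ⟨x, mem_ballF_self x n⟩
    have hs := card_ballF_succ_eq G x n
    simp only [hb]
    rw [hs, Nat.cast_add]
    linarith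
  -- (i) at least linear growth
  have hlin : ∀ n : ℕ, 1 + c * n ≤ b n := by
    intro n
    induction n with
    | zero => simpa using hb1 0
    | succ n ih =>
      have hpow : 1 ≤ (b n) ^ α := Real.one_le_rpow (hb1 n) hα0.le
      have hs := hstep n
      have hcp : c ≤ c * (b n) ^ α := le_mul_of_one_le_right hc.le hpow
      push_cast
      linarith
  -- (ii) the increments are eventually at least `2C + 2`
  have hCpos : 0 ≤ C := by
    have h0 := hC 0
    rw [hbv] at h0
    norm_num at h0
    linarith [hb1 0]
  obtain ⟨N, hN⟩ := exists_nat_ge ((((2 * C + 2) / c) ^ (1 / α) - 1) / c)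
  have hM : (2 * C + 2) / c ≤ (1 + c * (N : ℝ)) ^ α := by
    have h1 : ((2 * C + 2) / c) ^ (1 / α) ≤ 1 + c * (N : ℝ) := by
      have := (div_le_iff₀ hc).1 hN
      linarith
    have h0 : 0 ≤ (2 * C + 2) / c := by positivity
    calc (2 * C + 2) / c = (((2 * C + 2) / c) ^ (1 / α)) ^ α := by
          rw [← Real.rpow_mul h0, one_div_mul_cancel hα0.ne', Real.rpow_one]
      _ ≤ (1 + c * (N : ℝ)) ^ α := Real.rpow_le_rpow (by positivity) h1 hα0.le
  have hinc : ∀ m : ℕ, b N + m * (2 * C + 2) ≤ b (N + m) := by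
    intro m
    induction m with
    | zero => simp
    | succ m ih =>
      have hge : 1 + c * (N : ℝ) ≤ b (N + m) := by
        have h := hlin (N + m)
        push_cast at h
        have hcm : (0 : ℝ) ≤ c * (m : ℝ) := by positivity
        linarith
      have hpow : (2 * C + 2) / c ≤ (b (N + m)) ^ α := hM.trans (Real.rpow_le_rpow (by positivity) hge hα0.le)
      have h2 : 2 * C + 2 ≤ c * (b (N + m)) ^ α := by
        have := mul_le_mul_of_nonneg_left hpow hc.le
        rwa [mul_div_cancel₀ _ hc.ne'] at this
      have hs := hstep (N + m)
      rw [← add_assoc]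
      push_cast
      linarith
  -- (iii) contradiction with the linear bound at radius `N + (N + 1)`
  have h1 := hinc (N + 1)
  have h2 := hC (N + (N + 1))
  rw [hbv] at h2
  push_cast at h1 h2
  have e1 : ((N : ℝ) + 1) * (2 * C + 2) = 2 * ((N : ℝ) * C) + 2 * (N : ℝ) + 2 * C + 2 := by ring
  have e2 : C * ((N : ℝ) + ((N : ℝ) + 1) + 1) = 2 * ((N : ℝ) * C) + 2 * C := by ring
  have hN0 : (0 : ℝ) ≤ (N : ℝ) := Nat.cast_nonneg N
  linarith [hb1 N]

end Literature.Probability.Percolation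

end
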